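import Literature.NumberTheory.EllipticCurves.InertiaInvariantsAdditiveProofs
import Literature.NumberTheory.EllipticCurves.HasseWeilAbelianConductorOggSaito
import Literature.NumberTheory.EllipticCurves.HasseWeilAbelianArtinConductor
import Literature.NumberTheory.EllipticCurves.BSDConductorIdealFormProofs
import HarnessLib

/-!
# bsd.S15 from Ogg (`p = 3`) and Saito (`p = 2`) separately; unconditionally for curves with no
# additive reduction in residue characteristics `2` and `3`

`Proofs` file (theorems only, no definitions, no named facts) in topic
`NumberTheory/EllipticCurves`, landed by the tenured seat of bsd.S15
(`Literature.NumberTheory.EllipticCurves.conductorNorm_eq_artinConductorNat_of_isElliptic`,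
`BSDConductor`).  One-line assemblies of

* `InertiaInvariantsAdditiveProofs` — the C15 fact `a_v(V_ℓ E) = f_v(E)`
  (`WeierstrassCurve.artinConductorExponent_tate_eq_conductorExponent_of_isElliptic W ℓ`) from the
  single leaf `swanConductorAt_rationalTate_eq_wildConductorExponent_of_ringChar_eq W ℓ` (Ogg's
  formula for the wild part at the additive places of residue characteristic `2` or `3`), every
  other input of Silverman's Chapter IV route being a theorem of the tree; and
* `HasseWeilAbelianConductorOggSaito` — the split of that leaf into its `p = 3` half
  (`…_of_ringChar_eq_three`, Ogg 1967, **proved** in Silverman *ATAEC*, PDF pp. 366–371) and its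
  `p = 2` half (`…_of_ringChar_eq_two`, Saito 1988, Theorem 1, only **cited** by the book, p. 366),
  with the vacuous dischargers for curves lacking additive places of the residue characteristic
  in question.

## Main results

Over a number field `K` (the C15 fact and the corrected ideal fact
`artinConductor_tate_eq_conductor_of_isElliptic`, `𝔣^{(ℓ)}(V_ℓ E) · ∏_{v ∣ ℓ} v^{f_v} = 𝔣(E/K)`):

* `…_of_two_of_three` — from the two halves;
* `…_of_three_of_forall_not_hasAdditiveReductionAt_two` — from Ogg's `p = 3` theorem alone, for a
  curve with no additive place of residue characteristic `2`;
* `…_of_forall_not_hasAdditiveReductionAt` — **unconditionally** for a curve with no additive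
  place of residue characteristic `2` or `3` (e.g. semistable at those places, arbitrary
  elsewhere): this extends the tree's unconditional semistable case
  (`artinConductorExponent_tate_eq_conductorExponent_of_isSemistable`,
  `InertiaInvariantsMultiplicativeProofs`) to every curve whose additive places have residue
  characteristic `≥ 5`, where the wild part vanishes by Thm. IV.10.2(b) (a theorem:
  `swanConductorAt_rationalTate_eq_zero_of_ringChar_ne_holds`).

Over `ℚ` (bsd.S15: the corrected numerical fact `conductorNorm_eq_artinConductorNat_of_isElliptic`
— `N_E = N^{(ℓ)}(V_ℓ E)` for `ℓ ∤ N_E` —, its schema at elliptic `W`, the exponentwise schema and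
the ideal form): the same three versions, and the unconditional one also with the hypothesis
spelled on the two places `v₂, v₃` of `ℚ` (`Rat.HeightOneSpectrum.primesEquiv`):
`conductorNorm_eq_artinConductorNat_of_isElliptic_of_not_hasAdditiveReductionAt_two_three` — **for
an elliptic curve over `ℚ` with good or multiplicative reduction at `2` and at `3`, `N_E` is the
prime-to-`ℓ` Artin conductor of `V_ℓ E` for every prime `ℓ ∤ N_E`, with no hypothesis left.**

So after this file the trust base of bsd.S15 at an elliptic `W/ℚ` reads: nothing if `W` is not
additive at `2` and `3`; {Ogg's `p = 3` theorem as proved in *ATAEC* pp. 366–371} if `W` is not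
additive at `2`; {that, and Saito's theorem at `p = 2`} in general.

## References

* J. H. Silverman, *Advanced Topics in the Arithmetic of Elliptic Curves*, GTM 151 (1994), §IV.10
  (Definition p. 358, Thm. 10.2, Definition of `𝔣(E/K)` p. 364), §IV.11 (Ogg's formula 11.1,
  p. 365, and its proof, pp. 366–371). [SilvermanATAEC1994]
* A. P. Ogg, *Elliptic curves and wild ramification*, Amer. J. Math. 89 (1967). [OggAJM1967]
* T. Saito, *Conductor, discriminant, and the Noether formula of arithmetic surfaces*, Duke Math.
  J. 57 (1988), Theorem 1. [Saito1988]

## Design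

No definitions; one-line assemblies; `noncomputable section`; universe `u` for the number field.
The residue-characteristic hypotheses are those of the leaf (`ringChar (𝓞 K ⧸ v) = 2, 3`); over
`ℚ` they are converted to the places `v₂ = primesEquiv.symm 2`, `v₃ = primesEquiv.symm 3` by
`eq_primesEquiv_symm_of_ringChar_eq` (`natCast_ringChar_mem`,
`natCast_mem_asIdeal_iff_eq_primesEquiv_symm`).
-/

noncomputable section

open scoped Classical NumberField
open NumberField IsDedekindDomain Field

universe u

namespace WeierstrassCurve

open Literature.NumberTheory.EllipticCurves Literature.NumberTheory.GaloisRepresentations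

variable {K : Type u} [Field K] [NumberField K] (W : WeierstrassCurve K) (ℓ : ℕ) [Fact ℓ.Prime]

/-! ### Over a number field: the C15 fact and the corrected ideal fact -/

/-- **The C15 fact `a_v(V_ℓ E) = f_v(E)` from Ogg's `p = 3` theorem and Saito's `p = 2` theorem.**
For an elliptic curve over a number field, `artinConductorExponent_tate_eq_conductorExponent_of_isElliptic W ℓ`
follows from the two halves of Ogg's formula for the wild part at the additive places of residue
characteristic `2` (`h2`, Saito) and `3` (`h3`, Ogg; Silverman *ATAEC* pp. 366–371), by
`artinConductorExponent_tate_eq_conductorExponent_of_isElliptic_of_ringChar_eq`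
(`InertiaInvariantsAdditiveProofs`: Thm. IV.10.2 in full, Kodaira–Néron, Néron–Ogg–Shafarevich are
theorems).
[cite: SilvermanATAEC1994, Thm. IV.10.2 and IV.11.1 with its proof (PDF pp. 358–371)] -/
theorem artinConductorExponent_tate_eq_conductorExponent_of_isElliptic_of_two_of_three
    (h2 : W.swanConductorAt_rationalTate_eq_wildConductorExponent_of_ringChar_eq_two ℓ)
    (h3 : W.swanConductorAt_rationalTate_eq_wildConductorExponent_of_ringChar_eq_three ℓ) :
    W.artinConductorExponent_tate_eq_conductorExponent_of_isElliptic ℓ :=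
  W.artinConductorExponent_tate_eq_conductorExponent_of_isElliptic_of_ringChar_eq ℓ
    (W.swanConductorAt_rationalTate_eq_wildConductorExponent_of_ringChar_eq_of_two_of_three ℓ h2 h3)

/-- **The C15 fact from Ogg's `p = 3` theorem alone, for a curve with no additive place of
residue characteristic `2`** (there Saito's half is vacuous).
[cite: SilvermanATAEC1994, Thm. IV.10.2 and IV.11.1, case p = 3 (PDF pp. 358–371)] -/
theorem
    artinConductorExponent_tate_eq_conductorExponent_of_isElliptic_of_three_of_forall_not_hasAdditiveReductionAt_two
    (h3 : W.swanConductorAt_rationalTate_eq_wildConductorExponent_of_ringChar_eq_three ℓ)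
    (hna2 : ∀ v : HeightOneSpectrum (𝓞 K), ringChar (𝓞 K ⧸ v.asIdeal) = 2 →
      ¬ W.HasAdditiveReductionAt v) :
    W.artinConductorExponent_tate_eq_conductorExponent_of_isElliptic ℓ :=
  W.artinConductorExponent_tate_eq_conductorExponent_of_isElliptic_of_ringChar_eq ℓ
    (W.swanConductorAt_rationalTate_eq_wildConductorExponent_of_ringChar_eq_of_three_of_forall_not_hasAdditiveReductionAt_two
      ℓ h3 hna2)

/-- **The C15 fact, unconditionally, for a curve with no additive place of residue characteristic
`2` or `3`.**  For an elliptic curve `E/K` over a number field all of whose places of additive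
reduction have residue characteristic `≥ 5`, `a_v(V_ℓ E) = f_v(E)` at every `v ∤ ℓ` with no
hypothesis left: the leaf `swanConductorAt_rationalTate_eq_wildConductorExponent_of_ringChar_eq W ℓ`
is vacuous for such a curve, and everything else — Thm. IV.10.2(a), (b) (multiplicative places and
the clause `p ≥ 5`), the good places — is a theorem of the tree.  This extends the unconditional
semistable case `artinConductorExponent_tate_eq_conductorExponent_of_isSemistable`
(`InertiaInvariantsMultiplicativeProofs`).
[cite: SilvermanATAEC1994, Thm. IV.10.2(a),(b) (PDF pp. 358–362) with IV.11.1, case p ≥ 5 (p. 366)] -/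
theorem artinConductorExponent_tate_eq_conductorExponent_of_isElliptic_of_forall_not_hasAdditiveReductionAt
    (hna : ∀ v : HeightOneSpectrum (𝓞 K),
      ringChar (𝓞 K ⧸ v.asIdeal) = 2 ∨ ringChar (𝓞 K ⧸ v.asIdeal) = 3 →
        ¬ W.HasAdditiveReductionAt v) :
    W.artinConductorExponent_tate_eq_conductorExponent_of_isElliptic ℓ :=
  W.artinConductorExponent_tate_eq_conductorExponent_of_isElliptic_of_ringChar_eq ℓ
    (W.swanConductorAt_rationalTate_eq_wildConductorExponent_of_ringChar_eq_of_forall_not_hasAdditiveReductionAt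
      ℓ hna)

/-- **The corrected ideal fact `𝔣^{(ℓ)}(V_ℓ E) · ∏_{v ∣ ℓ} v^{f_v} = 𝔣(E/K)` from the leaf alone**
(`artinConductor_tate_eq_conductor_of_isElliptic W ℓ` of `HasseWeilAbelianArtinConductor`, through
`artinConductor_tate_eq_conductor_of_isElliptic_of_exponent`).
[cite: SilvermanATAEC1994, §IV.10 Definition of the conductor (PDF p. 364) with Thm. IV.10.2 and IV.11.1 (pp. 358–371)] -/
theorem artinConductor_tate_eq_conductor_of_isElliptic_of_ringChar_eq
    (hW23 : W.swanConductorAt_rationalTate_eq_wildConductorExponent_of_ringChar_eq ℓ) :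
    W.artinConductor_tate_eq_conductor_of_isElliptic ℓ :=
  W.artinConductor_tate_eq_conductor_of_isElliptic_of_exponent ℓ
    (W.artinConductorExponent_tate_eq_conductorExponent_of_isElliptic_of_ringChar_eq ℓ hW23)

/-- The corrected ideal fact from the two halves (Saito `p = 2`, Ogg `p = 3`).
[cite: SilvermanATAEC1994, §IV.10 Definition of the conductor (PDF p. 364) with Thm. IV.10.2 and IV.11.1 (pp. 358–371)] -/
theorem artinConductor_tate_eq_conductor_of_isElliptic_of_two_of_three
    (h2 : W.swanConductorAt_rationalTate_eq_wildConductorExponent_of_ringChar_eq_two ℓ)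
    (h3 : W.swanConductorAt_rationalTate_eq_wildConductorExponent_of_ringChar_eq_three ℓ) :
    W.artinConductor_tate_eq_conductor_of_isElliptic ℓ :=
  W.artinConductor_tate_eq_conductor_of_isElliptic_of_exponent ℓ
    (W.artinConductorExponent_tate_eq_conductorExponent_of_isElliptic_of_two_of_three ℓ h2 h3)

/-- **The corrected ideal fact, unconditionally, for a curve with no additive place of residue
characteristic `2` or `3`.**
[cite: SilvermanATAEC1994, §IV.10 Definition of the conductor (PDF p. 364) with Thm. IV.10.2(a),(b) (pp. 358–362)] -/
theorem artinConductor_tate_eq_conductor_of_isElliptic_of_forall_not_hasAdditiveReductionAt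
    (hna : ∀ v : HeightOneSpectrum (𝓞 K),
      ringChar (𝓞 K ⧸ v.asIdeal) = 2 ∨ ringChar (𝓞 K ⧸ v.asIdeal) = 3 →
        ¬ W.HasAdditiveReductionAt v) :
    W.artinConductor_tate_eq_conductor_of_isElliptic ℓ :=
  W.artinConductor_tate_eq_conductor_of_isElliptic_of_exponent ℓ
    (W.artinConductorExponent_tate_eq_conductorExponent_of_isElliptic_of_forall_not_hasAdditiveReductionAt
      ℓ hna)

omit [NumberField K] in
/-- If the residue ring `𝓞 K ⧸ v` has characteristic `p`, then `(p : 𝓞 K) ∈ v`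
(`natCast_ringChar_mem`). [folklore] -/
theorem _root_.IsDedekindDomain.HeightOneSpectrum.natCast_mem_of_ringChar_eq
    (v : HeightOneSpectrum (𝓞 K)) {p : ℕ} (hc : ringChar (𝓞 K ⧸ v.asIdeal) = p) :
    (p : 𝓞 K) ∈ v.asIdeal := by
  rw [← hc]
  exact v.natCast_ringChar_mem

/-- **The C15 fact, unconditionally, for a curve with no additive reduction at the places above
`2` and `3`** — the same as `…_of_forall_not_hasAdditiveReductionAt` with the hypothesis on the
places `v ∣ 2` and `v ∣ 3` (`(2 : 𝓞 K) ∈ v`, `(3 : 𝓞 K) ∈ v`) rather than on residue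
characteristics.
[cite: SilvermanATAEC1994, Thm. IV.10.2(a),(b) (PDF pp. 358–362) with IV.11.1, case p ≥ 5 (p. 366)] -/
theorem artinConductorExponent_tate_eq_conductorExponent_of_isElliptic_of_forall_mem_not_hasAdditiveReductionAt
    (hna : ∀ v : HeightOneSpectrum (𝓞 K), (2 : 𝓞 K) ∈ v.asIdeal ∨ (3 : 𝓞 K) ∈ v.asIdeal →
      ¬ W.HasAdditiveReductionAt v) :
    W.artinConductorExponent_tate_eq_conductorExponent_of_isElliptic ℓ := by
  refine W.artinConductorExponent_tate_eq_conductorExponent_of_isElliptic_of_forall_not_hasAdditiveReductionAt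
    ℓ fun v hv ↦ hna v ?_
  rcases hv with hv | hv
  · exact Or.inl (by simpa using v.natCast_mem_of_ringChar_eq hv)
  · exact Or.inr (by simpa using v.natCast_mem_of_ringChar_eq hv)

/-- **The corrected ideal fact, unconditionally, for a curve with no additive reduction at the
places above `2` and `3`.**
[cite: SilvermanATAEC1994, §IV.10 Definition of the conductor (PDF p. 364) with Thm. IV.10.2(a),(b) (pp. 358–362)] -/
theorem artinConductor_tate_eq_conductor_of_isElliptic_of_forall_mem_not_hasAdditiveReductionAt
    (hna : ∀ v : HeightOneSpectrum (𝓞 K), (2 : 𝓞 K) ∈ v.asIdeal ∨ (3 : 𝓞 K) ∈ v.asIdeal →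
      ¬ W.HasAdditiveReductionAt v) :
    W.artinConductor_tate_eq_conductor_of_isElliptic ℓ :=
  W.artinConductor_tate_eq_conductor_of_isElliptic_of_exponent ℓ
    (W.artinConductorExponent_tate_eq_conductorExponent_of_isElliptic_of_forall_mem_not_hasAdditiveReductionAt
      ℓ hna)

end WeierstrassCurve

/-! ### Over `ℚ`: bsd.S15 -/

namespace Literature.NumberTheory.EllipticCurves

open WeierstrassCurve

/-- A finite place `v` of `𝓞 ℚ` whose residue ring `𝓞 ℚ ⧸ v` has prime characteristic `p` is the
place above `p` (`Rat.HeightOneSpectrum.primesEquiv`): the residue characteristic lies in `v`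
(`natCast_ringChar_mem`) and a rational prime lies in `v` iff `v` is the place above it
(`natCast_mem_asIdeal_iff_eq_primesEquiv_symm`).  Bridge between the residue-characteristic
hypotheses of the C15 leaves and the two places `2, 3` of `ℚ`. [folklore] -/
theorem eq_primesEquiv_symm_of_ringChar_eq (v : HeightOneSpectrum (𝓞 ℚ)) {p : ℕ} (hp : p.Prime)
    (hc : ringChar (𝓞 ℚ ⧸ v.asIdeal) = p) :
    v = (Rat.HeightOneSpectrum.primesEquiv (R := 𝓞 ℚ)).symm ⟨p, hp⟩ := by
  rw [← natCast_mem_asIdeal_iff_eq_primesEquiv_symm v hp, ← hc]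
  exact v.natCast_ringChar_mem

variable (W : WeierstrassCurve ℚ) (ℓ : ℕ) [Fact ℓ.Prime]

/-- **bsd.S15 (numerical, corrected) from the leaf alone.**  For every `W / ℚ`, the corrected fact
`conductorNorm_eq_artinConductorNat_of_isElliptic W ℓ` (`N_E = N^{(ℓ)}(V_ℓ E)` for elliptic `W` and
`ℓ ∤ N_E`; Silverman *ATAEC* §IV.10 Definition of the conductor, PDF p. 364) follows from Ogg's
formula for the wild part at the additive places of residue characteristic `2, 3`
(`swanConductorAt_rationalTate_eq_wildConductorExponent_of_ringChar_eq W ℓ`) alone, by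
`conductorNorm_eq_artinConductorNat_of_isElliptic_of_tate` (`BSDConductorProofs`) and
`artinConductorExponent_tate_eq_conductorExponent_of_isElliptic_of_ringChar_eq`
(`InertiaInvariantsAdditiveProofs`).  This is the shape of the eventual discharge
`conductorNorm_eq_artinConductorNat_of_isElliptic_holds`.
[cite: SilvermanATAEC1994, §IV.10 Definition of the conductor (PDF p. 364) with Thm. IV.10.2 and IV.11.1 (pp. 358–371)] -/
theorem conductorNorm_eq_artinConductorNat_of_isElliptic_of_ringChar_eq
    (hW23 : W.swanConductorAt_rationalTate_eq_wildConductorExponent_of_ringChar_eq ℓ) :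
    conductorNorm_eq_artinConductorNat_of_isElliptic W ℓ :=
  conductorNorm_eq_artinConductorNat_of_isElliptic_of_tate W ℓ
    (W.artinConductorExponent_tate_eq_conductorExponent_of_isElliptic_of_ringChar_eq ℓ hW23)

/-- **bsd.S15 (numerical, corrected) from Ogg's `p = 3` theorem and Saito's `p = 2` theorem**
(the two halves of the leaf, `HasseWeilAbelianConductorOggSaito`).
[cite: SilvermanATAEC1994, §IV.10 Definition of the conductor (PDF p. 364) with Thm. IV.10.2 and IV.11.1 (pp. 358–371)] -/
theorem conductorNorm_eq_artinConductorNat_of_isElliptic_of_two_of_three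
    (h2 : W.swanConductorAt_rationalTate_eq_wildConductorExponent_of_ringChar_eq_two ℓ)
    (h3 : W.swanConductorAt_rationalTate_eq_wildConductorExponent_of_ringChar_eq_three ℓ) :
    conductorNorm_eq_artinConductorNat_of_isElliptic W ℓ :=
  conductorNorm_eq_artinConductorNat_of_isElliptic_of_tate W ℓ
    (W.artinConductorExponent_tate_eq_conductorExponent_of_isElliptic_of_two_of_three ℓ h2 h3)

/-- **bsd.S15 (numerical, corrected) from Ogg's `p = 3` theorem alone, for a curve over `ℚ` with
good or multiplicative reduction at the place of residue characteristic `2`.**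
[cite: SilvermanATAEC1994, §IV.10 Definition of the conductor (PDF p. 364) with Thm. IV.10.2 and IV.11.1, case p = 3 (pp. 358–371)] -/
theorem
    conductorNorm_eq_artinConductorNat_of_isElliptic_of_three_of_forall_not_hasAdditiveReductionAt_two
    (h3 : W.swanConductorAt_rationalTate_eq_wildConductorExponent_of_ringChar_eq_three ℓ)
    (hna2 : ∀ v : HeightOneSpectrum (𝓞 ℚ), ringChar (𝓞 ℚ ⧸ v.asIdeal) = 2 →
      ¬ W.HasAdditiveReductionAt v) :
    conductorNorm_eq_artinConductorNat_of_isElliptic W ℓ :=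
  conductorNorm_eq_artinConductorNat_of_isElliptic_of_tate W ℓ
    (W.artinConductorExponent_tate_eq_conductorExponent_of_isElliptic_of_three_of_forall_not_hasAdditiveReductionAt_two
      ℓ h3 hna2)

/-- **bsd.S15 (numerical, corrected), unconditionally, for a curve over `ℚ` with no additive
place of residue characteristic `2` or `3`** (residue-characteristic form of the hypothesis, as in
the leaf).  [cite: SilvermanATAEC1994, §IV.10 Definition of the conductor (PDF p. 364) with Thm. IV.10.2(a),(b) (pp. 358–362)] -/
theorem conductorNorm_eq_artinConductorNat_of_isElliptic_of_forall_not_hasAdditiveReductionAt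
    (hna : ∀ v : HeightOneSpectrum (𝓞 ℚ),
      ringChar (𝓞 ℚ ⧸ v.asIdeal) = 2 ∨ ringChar (𝓞 ℚ ⧸ v.asIdeal) = 3 →
        ¬ W.HasAdditiveReductionAt v) :
    conductorNorm_eq_artinConductorNat_of_isElliptic W ℓ :=
  conductorNorm_eq_artinConductorNat_of_isElliptic_of_tate W ℓ
    (W.artinConductorExponent_tate_eq_conductorExponent_of_isElliptic_of_forall_not_hasAdditiveReductionAt
      ℓ hna)

/-- **bsd.S15 for an elliptic curve over `ℚ` with good or multiplicative reduction at `2` and at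
`3` — no hypothesis left.**  Let `v₂`, `v₃` be the places of `𝓞 ℚ` above `2` and `3`
(`Rat.HeightOneSpectrum.primesEquiv`).  If `W / ℚ` does not have additive reduction at `v₂` nor at
`v₃` (in particular if it is semistable there; its reduction elsewhere is arbitrary), then for
every prime `ℓ` the corrected bsd.S15 fact `conductorNorm_eq_artinConductorNat_of_isElliptic W ℓ`
holds: for elliptic `W`, every continuity proof `h` and every `ℓ ∤ N_E`,
`N_E = W.conductorNorm ℤ = conductorNatOf (geomPoints W) ℓ h = N^{(ℓ)}(V_ℓ E)`.  Silverman *ATAEC*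
§IV.10: Definition of the conductor (PDF p. 364), Thm. IV.10.2(a) (tame part) and (b) (*"If `E/K`
has good or multiplicative reduction, or if `p ≥ 5`, then `δ(E/K) = 0`"*, p. 358) — all theorems
of the tree — cover every place of such a curve; Ogg–Saito is not needed.
[cite: SilvermanATAEC1994, §IV.10 Definition of the conductor (PDF p. 364) with Thm. IV.10.2(a),(b) (pp. 358–362)] -/
theorem conductorNorm_eq_artinConductorNat_of_isElliptic_of_not_hasAdditiveReductionAt_two_three
    (h2 : ¬ W.HasAdditiveReductionAt
      ((Rat.HeightOneSpectrum.primesEquiv (R := 𝓞 ℚ)).symm ⟨2, Nat.prime_two⟩))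
    (h3 : ¬ W.HasAdditiveReductionAt
      ((Rat.HeightOneSpectrum.primesEquiv (R := 𝓞 ℚ)).symm ⟨3, Nat.prime_three⟩)) :
    conductorNorm_eq_artinConductorNat_of_isElliptic W ℓ := by
  refine conductorNorm_eq_artinConductorNat_of_isElliptic_of_forall_not_hasAdditiveReductionAt W ℓ
    fun v hv ↦ ?_
  rcases hv with hv | hv
  · rwa [eq_primesEquiv_symm_of_ringChar_eq v Nat.prime_two hv]
  · rwa [eq_primesEquiv_symm_of_ringChar_eq v Nat.prime_three hv]

/-- **bsd.S15, schema form, for an elliptic `W / ℚ` not additive at `2` and `3` — no hypothesis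
left** (the schema `conductorNorm_eq_artinConductorNat W ℓ` at an elliptic `W`, by
`conductorNorm_eq_artinConductorNat_of_isElliptic_of'`).  Extends
`conductorNorm_eq_artinConductorNat_of_isSemistable` (`InertiaInvariantsMultiplicativeProofs`).
[cite: SilvermanATAEC1994, §IV.10 Definition of the conductor (PDF p. 364) with Thm. IV.10.2(a),(b) (pp. 358–362)] -/
theorem conductorNorm_eq_artinConductorNat_of_not_hasAdditiveReductionAt_two_three [W.IsElliptic]
    (h2 : ¬ W.HasAdditiveReductionAt
      ((Rat.HeightOneSpectrum.primesEquiv (R := 𝓞 ℚ)).symm ⟨2, Nat.prime_two⟩))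
    (h3 : ¬ W.HasAdditiveReductionAt
      ((Rat.HeightOneSpectrum.primesEquiv (R := 𝓞 ℚ)).symm ⟨3, Nat.prime_three⟩)) :
    conductorNorm_eq_artinConductorNat W ℓ :=
  conductorNorm_eq_artinConductorNat_of_isElliptic_of' W ℓ
    (conductorNorm_eq_artinConductorNat_of_isElliptic_of_not_hasAdditiveReductionAt_two_three W ℓ h2
      h3)

/-- **bsd.S15, schema form, from Ogg's `p = 3` theorem and Saito's `p = 2` theorem** at an
elliptic `W / ℚ`.
[cite: SilvermanATAEC1994, §IV.10 Definition of the conductor (PDF p. 364) with Thm. IV.10.2 and IV.11.1 (pp. 358–371)] -/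
theorem conductorNorm_eq_artinConductorNat_of_two_of_three [W.IsElliptic]
    (h2 : W.swanConductorAt_rationalTate_eq_wildConductorExponent_of_ringChar_eq_two ℓ)
    (h3 : W.swanConductorAt_rationalTate_eq_wildConductorExponent_of_ringChar_eq_three ℓ) :
    conductorNorm_eq_artinConductorNat W ℓ :=
  conductorNorm_eq_artinConductorNat_of_isElliptic_of' W ℓ
    (conductorNorm_eq_artinConductorNat_of_isElliptic_of_two_of_three W ℓ h2 h3)

/-- **bsd.S15, exponentwise schema `f_v(E) = a_v(V_ℓ E)` (`v ∤ ℓ`), for an elliptic `W / ℚ` with no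
additive place of residue characteristic `2` or `3` — no hypothesis left**
(`conductorExponent_eq_artinConductorExponent W ℓ`, by
`conductorExponent_eq_artinConductorExponent_of_isElliptic_of_tate`, `BSDConductorProofs`).
[cite: SilvermanATAEC1994, Thm. IV.10.2(a),(b) (PDF pp. 358–362) with IV.11.1 (p. 365)] -/
theorem conductorExponent_eq_artinConductorExponent_of_forall_not_hasAdditiveReductionAt
    [W.IsElliptic]
    (hna : ∀ v : HeightOneSpectrum (𝓞 ℚ),
      ringChar (𝓞 ℚ ⧸ v.asIdeal) = 2 ∨ ringChar (𝓞 ℚ ⧸ v.asIdeal) = 3 →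
        ¬ W.HasAdditiveReductionAt v) :
    conductorExponent_eq_artinConductorExponent W ℓ :=
  conductorExponent_eq_artinConductorExponent_of_isElliptic_of_tate W ℓ
    (W.artinConductorExponent_tate_eq_conductorExponent_of_isElliptic_of_forall_not_hasAdditiveReductionAt
      ℓ hna)

/-- **bsd.S15, ideal form `𝔣(E/ℚ) = 𝔣^{(ℓ)}(V_ℓ E) · (ℓ)^{f_ℓ}`, from the leaf alone** at an elliptic
`W / ℚ` (`conductor_eq_conductorOf_mul W ℓ`, by `conductor_eq_conductorOf_mul_of_isElliptic_of_tate`,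
`BSDConductorIdealFormProofs`).
[cite: SilvermanATAEC1994, §IV.10 Definition of the conductor (PDF p. 364) with Thm. IV.10.2 and IV.11.1 (pp. 358–371)] -/
theorem conductor_eq_conductorOf_mul_of_ringChar_eq [W.IsElliptic]
    (hW23 : W.swanConductorAt_rationalTate_eq_wildConductorExponent_of_ringChar_eq ℓ) :
    conductor_eq_conductorOf_mul W ℓ :=
  conductor_eq_conductorOf_mul_of_isElliptic_of_tate W ℓ
    (W.artinConductorExponent_tate_eq_conductorExponent_of_isElliptic_of_ringChar_eq ℓ hW23)

/-- **bsd.S15, ideal form, for an elliptic `W / ℚ` with no additive place of residue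
characteristic `2` or `3` — no hypothesis left.**
[cite: SilvermanATAEC1994, §IV.10 Definition of the conductor (PDF p. 364) with Thm. IV.10.2(a),(b) (pp. 358–362)] -/
theorem conductor_eq_conductorOf_mul_of_forall_not_hasAdditiveReductionAt [W.IsElliptic]
    (hna : ∀ v : HeightOneSpectrum (𝓞 ℚ),
      ringChar (𝓞 ℚ ⧸ v.asIdeal) = 2 ∨ ringChar (𝓞 ℚ ⧸ v.asIdeal) = 3 →
        ¬ W.HasAdditiveReductionAt v) :
    conductor_eq_conductorOf_mul W ℓ :=
  conductor_eq_conductorOf_mul_of_isElliptic_of_tate W ℓ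
    (W.artinConductorExponent_tate_eq_conductorExponent_of_isElliptic_of_forall_not_hasAdditiveReductionAt
      ℓ hna)

/-- The corrected ideal form `conductor_eq_conductorOf_mul_of_isElliptic W ℓ` (bsd.S15 (d),
`BSDConductor`) for a `W / ℚ` with no additive place of residue characteristic `2` or `3` — no
hypothesis left (ellipticity in the body).
[cite: SilvermanATAEC1994, §IV.10 Definition of the conductor (PDF p. 364) with Thm. IV.10.2(a),(b) (pp. 358–362)] -/
theorem conductor_eq_conductorOf_mul_of_isElliptic_of_forall_not_hasAdditiveReductionAt
    (hna : ∀ v : HeightOneSpectrum (𝓞 ℚ),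
      ringChar (𝓞 ℚ ⧸ v.asIdeal) = 2 ∨ ringChar (𝓞 ℚ ⧸ v.asIdeal) = 3 →
        ¬ W.HasAdditiveReductionAt v) :
    conductor_eq_conductorOf_mul_of_isElliptic W ℓ := by
  intro _ h
  exact conductor_eq_conductorOf_mul_of_forall_not_hasAdditiveReductionAt W ℓ hna h

end Literature.NumberTheory.EllipticCurves

end
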